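import Mathlib
import HarnessLib
import Summits.PneNP.PneNP.Theorems.CnfIdealGenLengthRankDefectRepresentationsCutLemmaMaxCut

/-!
# The cut lemma — registered stub `stub_cutLemma` (crux `RankDefectRepresentations` = stmt-PneNP-18923, line `rank-dehn-ladder`)

Rows `x : ι` and columns `y : ι'` of `R` carry cube colours `row x, col y : Fin n → Bool`; the `j`-th coordinate cut is
`R ∘ 1[row_j ≠ col_j]`.  THEOREM (negative rung N1 of the line, constants `C = 4`, `a = 1`):

  `stub_cutLemma : ∃ C a, ∀ K n ι ι' row col t R, (∀ j, rank (R ∘ 1[row_j ≠ col_j]) ≤ t) →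
      ∃ R' supported on {row = col}, rank (R − R') ≤ C (n+1)^a t`.

Proof (`Cruxes/RankDefectRepresentations/Lines/rank-dehn-ladder-N1-proof.md`, lead g7): pick a set of colours `B` maximising the
bipartition-cut rank `μ(B) = rank (R ∘ 1[(row∈B)×(col∉B)]) + rank (R ∘ 1[(row∉B)×(col∈B)])`; the MAX-CUT DECOMPOSITION
(`exists_blockDiagonal_of_maxCut`, from `…CutLemmaMaxCut.oneSided_decomposition` applied to `B` and `Bᶜ`) puts `R` within rank
`4 μ(B)` of a colour-block-diagonal matrix, and CUT DOMINATION (`…CutLemmaCutDominationMatrix.bipartitionCut_le_sum_coordinateCuts`,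
a polymatroid inequality on the hypercube) gives `μ(B) ≤ ∑_j rank (R ∘ 1[row_j ≠ col_j]) ≤ n t`.  Also recorded: the ADDITIVE CUT
INEQUALITY (A) of `Lines/rank-dehn-ladder-A-problem.md` §1 (`rank_le_sum_cuts_of_colourDisjoint`), conjectured and tested on ≈10⁹
instances by leads g2–g6.  By `…CutLemmaExtension.ext_of_cutLemma` (p620038) the one-step extension form `ExtensionStep` of
rank-stability follows with constants `(220, 1)`.
HONEST FRAMING: this closes rung N1; the item-deciding rung N0b (`stub_uniformStability`, n generators at once) remains open;
P ≠ NP is not moved; F-N2 is a FRONTIER formal rung.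
-/

set_option linter.dupNamespace false -- `Summit.PneNP.PneNP.…`: summit = sub-problem name (D-0017)

namespace Summit.PneNP.PneNP.Theorems.CnfIdealGenLengthRankDefectRepresentationsCutLemma

open Finset Matrix Module
open Literature.Computability.AlgebraicComplexity (rank_add_le)
open Summit.PneNP.PneNP.Theorems.CnfIdealGenLengthRankDefectRepresentationsCutLemmaMonotoneCuts (rank_pad_le)
open Summit.PneNP.PneNP.Theorems.CnfIdealGenLengthRankDefectRepresentationsCutLemmaCutDominationMatrix
  (bipartitionCut_le_sum_coordinateCuts)
open Summit.PneNP.PneNP.Theorems.CnfIdealGenLengthRankDefectRepresentationsCutLemmaMaxCut (oneSided_decomposition)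

variable {K : Type} [Field K]

section Assembly

variable {ι ι' Q : Type} [Fintype ι] [Fintype ι'] [DecidableEq ι] [DecidableEq ι'] [DecidableEq Q]

omit [DecidableEq Q] in
/-- Zero-padding a colour block does not change its rank: `rank (R ∘ 1[(row∈B)×(col∉C)]) = rank R|_{(row∈B)×(col∉C)}`.
[folklore] -/
theorem rank_padBlock_eq (row : ι → Q) (col : ι' → Q) (R : Matrix ι ι' K) (p : Q → Prop) (q : Q → Prop)
    [DecidablePred p] [DecidablePred q] :
    (Matrix.of fun x y => if p (row x) ∧ q (col y) then R x y else 0).rank =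
      (R.submatrix (Subtype.val : {x // p (row x)} → ι) (Subtype.val : {y // q (col y)} → ι')).rank := by
  apply le_antisymm
  · have : (Matrix.of fun x y => if p (row x) ∧ q (col y) then R x y else 0) =
        Matrix.of fun x y => if hx : p (row x) then (if hy : q (col y) then
          (R.submatrix (Subtype.val : {x // p (row x)} → ι) (Subtype.val : {y // q (col y)} → ι')) ⟨x, hx⟩ ⟨y, hy⟩
          else 0) else 0 := by
      ext x y
      by_cases hx : p (row x) <;> by_cases hy : q (col y) <;> simp [hx, hy]
    rw [this]; exact rank_pad_le _ _ _
  · have : R.submatrix (Subtype.val : {x // p (row x)} → ι) (Subtype.val : {y // q (col y)} → ι') =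
        (Matrix.of fun x y => if p (row x) ∧ q (col y) then R x y else 0).submatrix
          (Subtype.val : {x // p (row x)} → ι) (Subtype.val : {y // q (col y)} → ι') := by
      ext x y; simp [x.2, y.2]
    rw [this]; exact Matrix.rank_submatrix_le _ _ _

/-- **Max-cut decomposition** (Theorem 2 of `Lines/rank-dehn-ladder-N1-proof.md`).  If `B` maximises the bipartition-cut rank
`μ(B) = rank (R ∘ 1[(row∈B)×(col∉B)]) + rank (R ∘ 1[(row∉B)×(col∈B)])` over all sets of colours, then `R` is within rank
`4 μ(B)` of a matrix supported on the equal-colour cells. [folklore] -/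
theorem exists_blockDiagonal_of_maxCut [Fintype Q] (row : ι → Q) (col : ι' → Q) (R : Matrix ι ι' K) (B : Finset Q)
    (hmax : ∀ B' : Finset Q,
      (Matrix.of fun x y => if row x ∈ B' ∧ col y ∉ B' then R x y else 0).rank +
        (Matrix.of fun x y => if row x ∉ B' ∧ col y ∈ B' then R x y else 0).rank ≤
      (Matrix.of fun x y => if row x ∈ B ∧ col y ∉ B then R x y else 0).rank +
        (Matrix.of fun x y => if row x ∉ B ∧ col y ∈ B then R x y else 0).rank) :
    ∃ R' : Matrix ι ι' K, (∀ x y, row x ≠ col y → R' x y = 0) ∧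
      (R - R').rank ≤ 4 * ((Matrix.of fun x y => if row x ∈ B ∧ col y ∉ B then R x y else 0).rank +
        (Matrix.of fun x y => if row x ∉ B ∧ col y ∈ B then R x y else 0).rank) := by
  classical
  set Qm : Matrix ι ι' K := Matrix.of fun x y => if row x ∈ B ∧ col y ∉ B then R x y else 0 with hQm
  set Sm : Matrix ι ι' K := Matrix.of fun x y => if row x ∉ B ∧ col y ∈ B then R x y else 0 with hSm
  set Pm : Matrix ι ι' K := Matrix.of fun x y => if row x ∈ B ∧ col y ∈ B then R x y else 0 with hPm
  set Tm : Matrix ι ι' K := Matrix.of fun x y => if row x ∈ Bᶜ ∧ col y ∈ Bᶜ then R x y else 0 with hTm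
  -- the complement has the same cut, with the two blocks exchanged
  have cQ : (Matrix.of fun x y => if row x ∈ Bᶜ ∧ col y ∉ Bᶜ then R x y else 0) = Sm := by
    ext x y; simp [hSm]
  have cS : (Matrix.of fun x y => if row x ∉ Bᶜ ∧ col y ∈ Bᶜ then R x y else 0) = Qm := by
    ext x y; simp [hQm]
  obtain ⟨P₁, hP₁s, hP₁⟩ := oneSided_decomposition row col R B (fun i _ => hmax (B.erase i))
  have hmax' : ∀ i ∈ Bᶜ,
      (Matrix.of fun x y => if row x ∈ Bᶜ.erase i ∧ col y ∉ Bᶜ.erase i then R x y else 0).rank +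
        (Matrix.of fun x y => if row x ∉ Bᶜ.erase i ∧ col y ∈ Bᶜ.erase i then R x y else 0).rank ≤
      (Matrix.of fun x y => if row x ∈ Bᶜ ∧ col y ∉ Bᶜ then R x y else 0).rank +
        (Matrix.of fun x y => if row x ∉ Bᶜ ∧ col y ∈ Bᶜ then R x y else 0).rank := by
    intro i _
    rw [cQ, cS, add_comm Sm.rank]
    exact hmax (Bᶜ.erase i)
  obtain ⟨P₂, hP₂s, hP₂⟩ := oneSided_decomposition row col R Bᶜ hmax'
  rw [cQ, cS] at hP₂
  refine ⟨P₁ + P₂, fun x y hxy => ?_, ?_⟩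
  · rw [Matrix.add_apply, hP₁s x y (fun h => hxy h.1), hP₂s x y (fun h => hxy h.1), add_zero]
  have hR : R - (P₁ + P₂) = (Qm + Sm) + ((Pm - P₁) + (Tm - P₂)) := by
    have : R = Pm + Qm + Sm + Tm := by
      ext x y
      simp only [hPm, hQm, hSm, hTm, Matrix.add_apply, Matrix.of_apply, mem_compl]
      by_cases hx : row x ∈ B <;> by_cases hy : col y ∈ B <;> simp [hx, hy]
    rw [this]; abel
  rw [hR]
  have r0 := rank_add_le (Qm + Sm) ((Pm - P₁) + (Tm - P₂))
  have r1 := rank_add_le Qm Sm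
  have r2 := rank_add_le (Pm - P₁) (Tm - P₂)
  rw [← hQm, ← hSm, ← hPm] at hP₁
  rw [← hTm] at hP₂
  omega

/-- **The cut lemma** — the registered negative rung N1 `stub_cutLemma` of line `rank-dehn-ladder` (crux stmt-PneNP-18923),
with constants `C = 4`, `a = 1`: if every coordinate cut `R ∘ 1[row_j ≠ col_j]` has rank `≤ t`, then `R` is within rank
`4 (n+1) t` of a matrix supported on the equal-colour cells.  Proof: max-cut decomposition (`exists_blockDiagonal_of_maxCut`)
and cut domination (`…CutDominationMatrix.bipartitionCut_le_sum_coordinateCuts`). [folklore] -/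
theorem stub_cutLemma :
    ∃ C a : ℕ, ∀ (K : Type) [Field K] (n : ℕ) (ι ι' : Type) [Fintype ι] [Fintype ι']
      (row : ι → Fin n → Bool) (col : ι' → Fin n → Bool) (t : ℕ) (R : Matrix ι ι' K),
      (∀ j : Fin n, (Matrix.of fun x y => if row x j ≠ col y j then R x y else 0).rank ≤ t) →
        ∃ R' : Matrix ι ι' K, (∀ x y, row x ≠ col y → R' x y = 0) ∧ (R - R').rank ≤ C * (n + 1) ^ a * t := by
  refine ⟨4, 1, ?_⟩
  intro K _ n ι ι' _ _ row col t R hcut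
  classical
  obtain ⟨B, -, hB⟩ := Finset.exists_max_image (univ : Finset (Finset (Fin n → Bool)))
    (fun B' => (Matrix.of fun x y => if row x ∈ B' ∧ col y ∉ B' then R x y else 0).rank +
      (Matrix.of fun x y => if row x ∉ B' ∧ col y ∈ B' then R x y else 0).rank) univ_nonempty
  obtain ⟨R', hsupp, hrank⟩ := exists_blockDiagonal_of_maxCut row col R B (fun B' => hB B' (mem_univ _))
  refine ⟨R', hsupp, hrank.trans ?_⟩
  have hdom := bipartitionCut_le_sum_coordinateCuts (K := K) row col R B
  rw [← rank_padBlock_eq row col R (fun σ => σ ∈ B) (fun σ => σ ∉ B),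
    ← rank_padBlock_eq row col R (fun σ => σ ∉ B) (fun σ => σ ∈ B)] at hdom
  have hsum : ∑ j : Fin n, (Matrix.of fun x y => if row x j ≠ col y j then R x y else 0).rank ≤ n * t :=
    le_trans (Finset.sum_le_sum fun j _ => hcut j) (by simp)
  have : 4 * (n * t) ≤ 4 * (n + 1) ^ 1 * t := by
    rw [pow_one, mul_assoc]; exact Nat.mul_le_mul_left _ (Nat.mul_le_mul_right _ (Nat.le_succ n))
  exact le_trans (Nat.mul_le_mul_left 4 (hdom.trans hsum)) this

/-- **The additive cut inequality (A)** (`Lines/rank-dehn-ladder-A-problem.md` §1; conjectured by leads g2–g6, verified there on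
≈10⁹ instances): if no row colour equals a column colour, then `rank R ≤ ∑_j rank (R ∘ 1[row_j ≠ col_j])` — the rank of a
colour-disjoint block is at most the sum of its `2n` coordinate-cut block ranks. [folklore] -/
theorem rank_le_sum_cuts_of_colourDisjoint {n : ℕ} (row : ι → Fin n → Bool) (col : ι' → Fin n → Bool) (R : Matrix ι ι' K)
    (hdis : ∀ x y, row x ≠ col y) :
    R.rank ≤ ∑ j : Fin n, (Matrix.of fun x y => if row x j ≠ col y j then R x y else 0).rank := by
  classical
  set B : Finset (Fin n → Bool) := univ.image row with hB
  have hrow : ∀ x, row x ∈ B := fun x => mem_image_of_mem _ (mem_univ _)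
  have hcol : ∀ y, col y ∉ B := by
    intro y hy
    obtain ⟨x, -, hx⟩ := mem_image.mp hy
    exact hdis x y hx
  have e1 : R.rank = (R.submatrix (Subtype.val : {x // row x ∈ B} → ι) (Subtype.val : {y // col y ∉ B} → ι')).rank := by
    have : R.submatrix (Subtype.val : {x // row x ∈ B} → ι) (Subtype.val : {y // col y ∉ B} → ι') =
        R.submatrix (Equiv.subtypeUnivEquiv hrow) (Equiv.subtypeUnivEquiv hcol) := by
      ext x y; rfl
    rw [this, Matrix.rank_submatrix]
  rw [e1]
  exact le_trans (Nat.le_add_right _ _) (bipartitionCut_le_sum_coordinateCuts row col R B)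


end Assembly

end Summit.PneNP.PneNP.Theorems.CnfIdealGenLengthRankDefectRepresentationsCutLemma
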